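import Summits.Ventures.HodgeRepro2.T5SU11ResolventNeumannSeries

/-!
# The resolvent is Lipschitz in the spectral parameter, uniformly on the weighted space

On the weighted space `|g(s)| ≤ N e^{−εs}` (`2 − λ₂ < ε < λ₂`, `c₂` the bound of `G^I_{λ₂}` of row 506) the Neumann
series of row 507 starts with `G^I_{λ₂} g(t)`, and its tail is dominated by the geometric series
`c₂ N e^{−εt} (|μ − μ₂| c₂)^k`, `k ≥ 1`; hence, for `|μ − μ₂| c₂ < 1` and every `t > 0`,

**`|G^I_λ g(t) − G^I_{λ₂} g(t)| ≤ (c₂ · |μ − μ₂| c₂ / (1 − |μ − μ₂| c₂)) · N e^{−εt}`** (`abs_greenSolI_sub_le`)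

— a Lipschitz bound in `μ` for the resolvent as an operator of the weighted sup-norm, with constant
`c₂²/(1 − |μ − μ₂| c₂)` (`abs_greenSolI_sub_le'`); in particular the resolvent is continuous in the spectral parameter
in operator norm, not only pointwise (row 508). Nothing is claimed about (N).

Blind lane: Mathlib + the HodgeRepro2 prefix only; no sorry; axioms ⊆ {propext, Classical.choice,
Quot.sound}.
-/

namespace Summit.Ventures.HodgeRepro2.T5SU11ResolventLipschitz

open Filter Topology MeasureTheory
open Set (Ioi Ioc)
open T5SU11Cartan T5SU11SphericalFunction T5SU11SphericalDecay T5SU11RadialGreenImproper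
  T5SU11ResolventNeumannSeries

section measure

variable [MeasurableSpace Circle] [BorelSpace Circle]

variable {lam lam₂ ε : ℝ} (hlam : 1 < lam) (hlam₂ : 1 < lam₂) (hε₁ : 2 - lam < ε) (hε₂ : 2 - lam₂ < ε)
  (hε₃ : ε < lam)
  {g : ℝ → ℝ} (hg : ContinuousOn g (Ioi 0)) {N : ℝ} (hN0 : 0 ≤ N)
  (hN : ∀ s, 0 < s → |g s| ≤ N * Real.exp (-ε * s))
  {c₂ : ℝ} (hc₂ : 0 ≤ c₂)
  (hbound : ∀ (h : ℝ → ℝ) (N' : ℝ), ContinuousOn h (Ioi 0) → 0 ≤ N' →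
    (∀ s, 0 < s → |h s| ≤ N' * Real.exp (-ε * s)) →
    ∀ t, 0 < t → |greenSolI (fun t => sph lam₂ (hyp t)) (sphDecay lam₂) h t| ≤ c₂ * N' * Real.exp (-ε * t))

include hlam hlam₂ hε₁ hε₂ hε₃ hg hN0 hN hc₂ hbound in
/-- **THE RESOLVENT IS LIPSCHITZ IN THE SPECTRAL PARAMETER ON THE WEIGHTED SPACE**: for `|μ − μ₂| c₂ < 1`,
`|G^I_λ g(t) − G^I_{λ₂} g(t)| ≤ c₂ · (|μ − μ₂| c₂)/(1 − |μ − μ₂| c₂) · N e^{−εt}`. -/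
theorem abs_greenSolI_sub_le (hq : |lam * (lam - 2) - lam₂ * (lam₂ - 2)| * c₂ < 1) {t : ℝ} (ht : 0 < t) :
    |greenSolI (fun t => sph lam (hyp t)) (sphDecay lam) g t - greenSolI (fun t => sph lam₂ (hyp t)) (sphDecay lam₂) g t|
      ≤ c₂ * (|lam * (lam - 2) - lam₂ * (lam₂ - 2)| * c₂) / (1 - |lam * (lam - 2) - lam₂ * (lam₂ - 2)| * c₂)
        * N * Real.exp (-ε * t) := by
  set q := |lam * (lam - 2) - lam₂ * (lam₂ - 2)| * c₂ with hq'
  have hq0 : 0 ≤ q := by positivity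
  set a : ℕ → ℝ := fun k => (lam * (lam - 2) - lam₂ * (lam₂ - 2)) ^ k
    * (greenSolI (fun t => sph lam₂ (hyp t)) (sphDecay lam₂))^[k + 1] g t with ha
  have hS : HasSum a (greenSolI (fun t => sph lam (hyp t)) (sphDecay lam) g t) :=
    hasSum_neumann_series hlam hlam₂ hε₁ hε₂ hε₃ hg hN0 hN hc₂ hbound hq ht
  have hsum : Summable a := hS.summable
  -- the tail `∑' i, a (i + 1)` is the difference
  have hsplit := hsum.sum_add_tsum_nat_add 1
  rw [hS.tsum_eq, Finset.sum_range_one] at hsplit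
  have ha0 : a 0 = greenSolI (fun t => sph lam₂ (hyp t)) (sphDecay lam₂) g t := by
    simp [ha]
  rw [ha0] at hsplit
  -- the geometric domination of the tail
  have hgeom : HasSum (fun i : ℕ => c₂ * N * Real.exp (-ε * t) * q * q ^ i)
      (c₂ * N * Real.exp (-ε * t) * q * (1 - q)⁻¹) :=
    (hasSum_geometric_of_lt_one hq0 hq).mul_left _
  have hb := tsum_of_norm_bounded hgeom (fun i => by
    rw [Real.norm_eq_abs]
    have := abs_neumann_term_le (lam := lam) hlam₂ hε₂ hg hN0 hN hc₂ hbound (i + 1) ht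
    rw [show q ^ (i + 1) = q * q ^ i by ring] at this
    calc |a (i + 1)| ≤ c₂ * N * Real.exp (-ε * t) * (q * q ^ i) := this
      _ = c₂ * N * Real.exp (-ε * t) * q * q ^ i := by ring)
  rw [Real.norm_eq_abs] at hb
  have e : greenSolI (fun t => sph lam (hyp t)) (sphDecay lam) g t
      - greenSolI (fun t => sph lam₂ (hyp t)) (sphDecay lam₂) g t = ∑' i, a (i + 1) := by linarith
  rw [e]
  calc |∑' i, a (i + 1)| ≤ c₂ * N * Real.exp (-ε * t) * q * (1 - q)⁻¹ := hb
    _ = c₂ * q / (1 - q) * N * Real.exp (-ε * t) := by ring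

include hlam hlam₂ hε₁ hε₂ hε₃ hg hN0 hN hc₂ hbound in
/-- The same bound with the explicit Lipschitz constant `c₂²/(1 − |μ − μ₂| c₂)` in front of `|μ − μ₂|`. -/
theorem abs_greenSolI_sub_le' (hq : |lam * (lam - 2) - lam₂ * (lam₂ - 2)| * c₂ < 1) {t : ℝ} (ht : 0 < t) :
    |greenSolI (fun t => sph lam (hyp t)) (sphDecay lam) g t - greenSolI (fun t => sph lam₂ (hyp t)) (sphDecay lam₂) g t|
      ≤ c₂ ^ 2 / (1 - |lam * (lam - 2) - lam₂ * (lam₂ - 2)| * c₂) * |lam * (lam - 2) - lam₂ * (lam₂ - 2)|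
        * N * Real.exp (-ε * t) := by
  have h := abs_greenSolI_sub_le hlam hlam₂ hε₁ hε₂ hε₃ hg hN0 hN hc₂ hbound hq ht
  calc _ ≤ _ := h
    _ = c₂ ^ 2 / (1 - |lam * (lam - 2) - lam₂ * (lam₂ - 2)| * c₂) * |lam * (lam - 2) - lam₂ * (lam₂ - 2)|
        * N * Real.exp (-ε * t) := by ring

end measure

end Summit.Ventures.HodgeRepro2.T5SU11ResolventLipschitz
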